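import Summits.ResolutionOfSingularities.ResolutionOfSingularities.Theorems.ValuativeLuAlphaPTorsorDiscreteRounds
import Summits.ResolutionOfSingularities.ResolutionOfSingularities.Theorems.ValuativeLuAlphaPTorsorDiscreteFreeRegime

/-!
# `π` enters the quadratic sequence along a discrete rank-one valuation (every dimension)

Helper file for the line `pfaff-line-log-final-forms` of the crux `Valuative.LuAlphaPTorsor`
(item `stmt-ResolutionOfSingularities-0641`), branch `DiscreteAllDim`, registered stub
`discreteAllDim_mem` (layer L1).

Setting: `R 0 → R 1 → ⋯` is a sequence of quadratic transforms of a local ring `R 0` of the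
field `K'` along a valuation ring `O'` dominating `R 0`; the value group of `O'` is discrete of
rank one, generated by `v(π)`, `v(π) < 1`. PROVED (`discreteAllDim_mem`): `π ∈ R i₀` for some
`i₀`. This replaces Abhyankar's two-dimensional union lemma by an elementary argument valid in
every dimension.

Proof. If `π = 0` take `i₀ = 0`. Otherwise write `π = a / b` with `a, b ∈ R 0`, `b ≠ 0`
(`R 0` is a local ring *of* `K'`). Every `R j` is dominated by `O'`, so a non-zero `b ∈ R j` has
`v(b) = v(π)^n` with `n : ℕ`; induct strongly on `n`, for all stages `j` at once. If `n = 0`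
then `b` is a unit of `R j` and `π = a b⁻¹ ∈ R j`. If `n ≥ 1` then `b` and `a = π b` are
non-units of `R j`; the chart element `x` of the step `R j → R (j + 1)` has the largest value
among the non-units, so `v(b) ≤ v(x) = v(π)^m < 1`, `1 ≤ m ≤ n`, and `a/x, b/x ∈ R (j + 1)` with
`v(b/x) = v(π)^(n - m)`, `n - m < n`, `π = (a/x) / (b/x)`: apply the induction hypothesis at the
stage `j + 1`. [folklore]
-/

set_option linter.dupNamespace false

namespace Summit.ResolutionOfSingularities.ResolutionOfSingularities.Theorems.PfaffLine

open IsLocalRing Literature.AlgebraicGeometry.Resolution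

open DiscreteRounds in
/-- **`π` enters the sequence (every dimension).** Along a sequence `R 0 → R 1 → ⋯` of quadratic
transforms of a local ring `R 0` of `K'` along a valuation ring `O'` dominating `R 0`, with
discrete rank-one value group generated by `v(π) < 1`, the element `π` lies in some member
`R i₀`. Proof: write `π = a / b` over `R j` and induct strongly on the exponent `n` of
`v(b) = v(π)^n`: if `n = 0` then `b` is a unit; otherwise `a, b` are non-units, and dividing by
the chart element `x` of the step `R j → R (j + 1)` (`v(b) ≤ v(x) < 1`) gives
`π = (a/x) / (b/x)` over `R (j + 1)` with a smaller exponent. [folklore] -/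
theorem discreteAllDim_mem :
    ∀ (K' : Type) [Field K'] (O' : ValuationSubring K') (R : ℕ → Subring K') (π : K'), Literature.AlgebraicGeometry.Resolution.IsLocalRingOf (R 0) → Literature.AlgebraicGeometry.Resolution.SubringDominates (R 0) O'.toSubring → (∀ i, Literature.AlgebraicGeometry.Resolution.IsQuadraticTransformAlong O' (R i) (R (i + 1))) → O'.valuation π < 1 → (∀ z : K', z ≠ 0 → ∃ n : ℤ, O'.valuation z = O'.valuation π ^ n) → ∃ i₀ : ℕ, π ∈ R i₀ := by
  intro K' _ O' R π hof hdom hstep hπ1 hdisc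
  -- the degenerate case `π = 0`
  by_cases hπ0 : π = 0
  · exact ⟨0, by rw [hπ0]; exact (R 0).zero_mem⟩
  -- every member of the sequence is dominated by `O'`
  have hRO : ∀ n, SubringDominates (R n) O'.toSubring := fun n =>
    (sequence_dominates hdom hstep n).1
  have hγ0 : O'.valuation π ≠ 0 := (Valuation.ne_zero_iff _).mpr hπ0
  have hγpos : 0 < O'.valuation π := (Valuation.pos_iff _).mpr hπ0
  -- ### strong induction on the exponent `n` of `v(b) = v(π)^n`, for all stages `j` at once
  suffices key : ∀ (n j : ℕ) (a b : K'), a ∈ R j → b ∈ R j → b ≠ 0 →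
      O'.valuation b = O'.valuation π ^ n → π = a / b → ∃ i₀ : ℕ, π ∈ R i₀ by
    obtain ⟨a, ha, b, hb, hb0, hab⟩ := hof.2 π
    obtain ⟨n, hn⟩ := exists_nat_of_valuation_le_one hπ0 hπ1 hdisc ((hRO 0).1 hb) hb0
    exact key n 0 a b ha hb hb0 hn hab
  intro n
  induction n using Nat.strong_induction_on with
  | _ n ih =>
  intro j a b ha hb hb0 hvb hab
  by_cases hn0 : n = 0
  · -- `v(b) = 1`: `b` is a unit of `R j`, so `π = a b⁻¹ ∈ R j`
    subst hn0
    rw [pow_zero] at hvb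
    refine ⟨j, ?_⟩
    rw [hab, div_eq_mul_inv]
    exact (R j).mul_mem ha (inv_mem_subring_of_valuation_eq_one (hRO j) hb hvb)
  -- `n ≥ 1`: `b` and `a = π b` are non-units of the local ring `R j`
  have hvb1 : O'.valuation b < 1 := by
    rw [hvb]
    exact pow_lt_one₀ zero_le hπ1 hn0
  have hae : a = π * b := by rw [hab, div_mul_cancel₀ a hb0]
  have hva1 : O'.valuation a < 1 := by
    rw [hae, map_mul, hvb, ← pow_succ']
    exact pow_lt_one₀ zero_le hπ1 (Nat.succ_ne_zero n)
  -- the chart element `x` of the step `R j → R (j + 1)`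
  obtain ⟨_, x, hxm, hx0, hxmax, hR⟩ := (hstep j).exists_eq_locAtCentre
  have hbm : (⟨b, hb⟩ : R j) ∈ maximalIdeal (R j) :=
    (mem_maximalIdeal_iff_inv_not_mem _).mpr
      (Or.inr (inv_not_mem_subring_of_valuation_lt_one (hRO j).1 hb0 hvb1))
  have ham : (⟨a, ha⟩ : R j) ∈ maximalIdeal (R j) := by
    by_cases ha0 : a = 0
    · exact (mem_maximalIdeal_iff_inv_not_mem _).mpr (Or.inl ha0)
    · exact (mem_maximalIdeal_iff_inv_not_mem _).mpr
        (Or.inr (inv_not_mem_subring_of_valuation_lt_one (hRO j).1 ha0 hva1))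
  have hx0K : ((x : R j) : K') ≠ 0 := fun e => hx0 (Subtype.ext e)
  have hxinv : ((x : R j) : K')⁻¹ ∉ R j := fun hi =>
    ((mem_maximalIdeal_iff_inv_not_mem x).mp hxm).elim hx0K (· hi)
  -- `v(b) ≤ v(x) = v(π)^m < 1`, so `1 ≤ m ≤ n`
  have hvx1 : O'.valuation ((x : R j) : K') < 1 :=
    valuation_lt_one_of_subringDominates (hRO j) x.2 hxinv
  obtain ⟨m, hm⟩ := exists_nat_of_valuation_le_one hπ0 hπ1 hdisc ((hRO j).1 x.2) hx0K
  have hm0 : m ≠ 0 := by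
    rintro rfl
    rw [pow_zero] at hm
    rw [hm] at hvx1
    exact lt_irrefl _ hvx1
  have hbx : O'.valuation b ≤ O'.valuation ((x : R j) : K') := hxmax ⟨b, hb⟩ hbm
  have hmn : m ≤ n := by
    rw [hvb, hm] at hbx
    exact (pow_le_pow_iff_right_of_lt_one₀ hγpos hπ1).mp hbx
  -- `a/x, b/x ∈ R[𝔪/x] ⊆ R (j + 1)`, `v(b/x) = v(π)^(n - m)` and `π = (a/x) / (b/x)`
  have ha' : a / ((x : R j) : K') ∈ R (j + 1) := by
    rw [hR]
    exact le_locAtCentre _ O' (div_mem_blowupRing (x : K') ham)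
  have hb' : b / ((x : R j) : K') ∈ R (j + 1) := by
    rw [hR]
    exact le_locAtCentre _ O' (div_mem_blowupRing (x : K') hbm)
  have hb'0 : b / ((x : R j) : K') ≠ 0 := div_ne_zero hb0 hx0K
  have hvb' : O'.valuation (b / ((x : R j) : K')) = O'.valuation π ^ (n - m) := by
    rw [map_div₀, hvb, hm, pow_sub₀ _ hγ0 hmn, div_eq_mul_inv]
  have hab' : π = a / ((x : R j) : K') / (b / ((x : R j) : K')) := by
    rw [div_div_div_cancel_right₀ hx0K]
    exact hab
  exact ih (n - m) (by omega) (j + 1) _ _ ha' hb' hb'0 hvb' hab'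

end Summit.ResolutionOfSingularities.ResolutionOfSingularities.Theorems.PfaffLine
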